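import Mathlib.NumberTheory.Chebyshev
import Mathlib.Analysis.SpecialFunctions.Sqrt
import Mathlib.Analysis.Real.Pi.Bounds
import Literature.Barriers.Parity.HensleyRichards
import Literature.NumberTheory.LFunctions.ThetaSmallRange
import Literature.NumberTheory.LFunctions.ChebyshevSylvesterPsi
import HarnessLib

/-!
# Toward `η_prm = 60` in [IUTchIV] Prop. 1.6: the integral `∫ θ(t)/(t·log² t) dt` from the tree's `θ`-bounds

Topic `Literature/IUT/LogVolume` (support file of `EtaPrmSixty.lean`, which proves `π(x) ≤ (4/3)·x/log x` for
`x ≥ 60` — a weak form of Rosser–Schoenfeld's (3.6) «`π(x) < 1.25506·x/log x` for `1 < x`» — and hence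
`IsEtaPrm 60`). Rosser–Schoenfeld obtain `π` from `θ` by partial summation (their §4–§5); here the partial summation
is Mathlib's `Chebyshev.primeCounting_eq_theta_div_log_add_integral`, `π(x) = θ(x)/log x + ∫₂ˣ θ(t)/(t log² t) dt`,
and this file bounds the integral from `θ`-estimates PROVED in the tree:

* `integral_inv_log_sq_le`: `∫ₐᵇ dt/log² t ≤ (b/log² b − a/log² a)/c` if `c ≤ 1 − 2/log t` on `[a,b]`
  (`(t/log² t)' = (1 − 2/log t)/log² t`); `integral_inv_sqrt`: `∫ₐᵇ dt/√t = 2(√b − √a)`;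
* `theta_table`: the tree's kernel-certified Schoenfeld-form table `|θ(t) − t| ≤ √t·log² t/(8π)` on `[599, 8886113]`
  (`Literature.NumberTheory.LFunctions.abs_theta_sub_le_smallRange`); `theta_le_large`: `θ(t) ≤ 1.075·t` for
  `t ≥ 8886113` from the tree's Chebyshev–Sylvester bound `ψ(t) ≤ 1.0722·t + 7√t` (`psi_le_sylvester`);
* `integral_table_le`: `∫_{1024}^x θ/(t log² t) ≤ (x/log² x − 1024/log² 1024)/0.7114 + (√x − 32)/(4π)` for
  `1024 ≤ x ≤ 8886113`; `integral_large_le`: `∫ₐˣ θ/(t log² t) ≤ 1.075·(8/7)·(x/log² x − a/log² a)` for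
  `8886113 ≤ a ≤ x`; `integral_two_1024`: `∫₂^{1024} θ/(t log² t) = 172 − θ(1024)/log 1024` (`π(1024) = 172` by
  Legendre's identity `Literature.Barriers.Parity.primeCounting_eq_add_card_coprime_factorial` and a kernel count).

Everything is PROVED (no named fact); classical and undisputed; standard axioms only.
-/

noncomputable section

namespace Literature.IUT.LogVolume

namespace EtaPrmSixty

open Real MeasureTheory Set intervalIntegral
open scoped Nat.Prime Chebyshev

/-! ## 1. Numerical constants -/

/-- `log 1024 = 10·log 2`. [folklore] -/
private theorem log_1024 : Real.log 1024 = 10 * Real.log 2 := by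
  rw [show (1024 : ℝ) = 2 ^ 10 by norm_num, Real.log_pow]; norm_num

/-- `6.9314718 < log 1024 < 6.9314719`. [folklore] -/
private theorem log_1024_bounds : 6.9314718 < Real.log 1024 ∧ Real.log 1024 < 6.9314719 := by
  rw [log_1024]
  constructor <;> linarith [Real.log_two_gt_d9, Real.log_two_lt_d9]

/-- `√1024 = 32`. [folklore] -/
private theorem sqrt_1024 : Real.sqrt 1024 = 32 := by
  rw [show (1024 : ℝ) = 32 ^ 2 by norm_num, Real.sqrt_sq (by norm_num)]

/-! ## 3. Two elementary integrals -/

/-- `F(t) = t/log² t` has derivative `1/log² t − 2/log³ t` at `t > 1`. [folklore] -/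
private theorem hasDerivAt_F {t : ℝ} (ht : 1 < t) :
    HasDerivAt (fun u : ℝ => u / Real.log u ^ 2) (1 / Real.log t ^ 2 - 2 / Real.log t ^ 3) t := by
  have ht0 : t ≠ 0 := by positivity
  have hlog : Real.log t ≠ 0 := (Real.log_pos ht).ne'
  have h1 : HasDerivAt (fun u : ℝ => u) 1 t := hasDerivAt_id t
  have h2 := (Real.hasDerivAt_log ht0).fun_pow 2
  have h3 := h1.div h2 (pow_ne_zero 2 hlog)
  refine h3.congr_deriv ?_
  field_simp
  ring

/-- Continuity of `t ↦ 1/log t ^ n` on `[a, b]` for `a > 1`. [folklore] -/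
private theorem continuousOn_inv_log_pow (n : ℕ) {a b : ℝ} (ha : 1 < a) (hab : a ≤ b) :
    ContinuousOn (fun t : ℝ => 1 / Real.log t ^ n) (Set.uIcc a b) := by
  rw [Set.uIcc_of_le hab]
  apply ContinuousOn.div continuousOn_const
  · apply ContinuousOn.pow
    exact Real.continuousOn_log.mono fun t ht => by
      simp only [Set.mem_compl_iff, Set.mem_singleton_iff]; exact ne_of_gt (by linarith [ht.1])
  · intro t ht; exact pow_ne_zero n (Real.log_pos (by linarith [ht.1])).ne'

/-- **`∫ₐᵇ dt/log² t ≤ (b/log² b − a/log² a)/c`** whenever `0 < c ≤ 1 − 2/log t` on `[a, b]` (`a > 1`): since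
`(t/log² t)' = (1/log² t)(1 − 2/log t) ≥ c/log² t` — the elementary integral of the partial summation by which
Rosser–Schoenfeld pass from `θ` to `π`. [cite: RosserSchoenfeld1962, §4–§5 (π from θ by partial summation; elementary form)] -/
theorem integral_inv_log_sq_le {a b c : ℝ} (ha : 1 < a) (hab : a ≤ b) (hc : 0 < c)
    (hcl : ∀ t ∈ Set.Icc a b, c ≤ 1 - 2 / Real.log t) :
    ∫ t in a..b, 1 / Real.log t ^ 2 ≤ (b / Real.log b ^ 2 - a / Real.log a ^ 2) / c := by
  have hderiv : ∀ t ∈ Set.uIcc a b,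
      HasDerivAt (fun u : ℝ => u / Real.log u ^ 2) (1 / Real.log t ^ 2 - 2 / Real.log t ^ 3) t := by
    intro t ht; rw [Set.uIcc_of_le hab] at ht; exact hasDerivAt_F (by linarith [ht.1])
  have hcont : ContinuousOn (fun t : ℝ => 1 / Real.log t ^ 2 - 2 / Real.log t ^ 3) (Set.uIcc a b) := by
    have h2 := continuousOn_inv_log_pow 2 ha hab
    have h3 := continuousOn_inv_log_pow 3 ha hab
    have : (fun t : ℝ => 1 / Real.log t ^ 2 - 2 / Real.log t ^ 3) =
        fun t => 1 / Real.log t ^ 2 - 2 * (1 / Real.log t ^ 3) := by funext t; ring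
    rw [this]; exact h2.sub (h3.const_smul (2 : ℝ) |>.congr fun t _ => by simp [smul_eq_mul])
  have hFTC := intervalIntegral.integral_eq_sub_of_hasDerivAt hderiv hcont.intervalIntegrable
  -- pointwise comparison `1/log² t ≤ (1/c)·(1/log² t − 2/log³ t)`
  have hpt : ∀ t ∈ Set.Icc a b,
      1 / Real.log t ^ 2 ≤ (1 / c) * (1 / Real.log t ^ 2 - 2 / Real.log t ^ 3) := by
    intro t ht
    have hlt : 0 < Real.log t := Real.log_pos (by linarith [ht.1])
    have hct := hcl t ht
    have h1 : c * Real.log t ≤ Real.log t - 2 := by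
      have := mul_le_mul_of_nonneg_right hct hlt.le
      rwa [sub_mul, div_mul_cancel₀ _ hlt.ne', one_mul] at this
    have key : (1 / c) * (1 / Real.log t ^ 2 - 2 / Real.log t ^ 3) - 1 / Real.log t ^ 2 =
        ((Real.log t - 2) - c * Real.log t) / (c * Real.log t ^ 3) := by
      field_simp
    have : 0 ≤ ((Real.log t - 2) - c * Real.log t) / (c * Real.log t ^ 3) :=
      div_nonneg (by linarith) (by positivity)
    linarith [key]
  have hmono := intervalIntegral.integral_mono_on hab
    ((continuousOn_inv_log_pow 2 ha hab).intervalIntegrable (μ := volume))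
    ((hcont.intervalIntegrable (μ := volume)).const_mul (1 / c)) hpt
  rw [intervalIntegral.integral_const_mul, hFTC] at hmono
  calc ∫ t in a..b, 1 / Real.log t ^ 2 ≤ 1 / c * (b / Real.log b ^ 2 - a / Real.log a ^ 2) := hmono
    _ = (b / Real.log b ^ 2 - a / Real.log a ^ 2) / c := by ring

/-- **`∫ₐᵇ dt/√t = 2(√b − √a)`** for `0 < a ≤ b` (the error-term integral of the same partial summation).
[cite: RosserSchoenfeld1962, §4–§5 (π from θ by partial summation; elementary form)] -/
theorem integral_inv_sqrt {a b : ℝ} (ha : 0 < a) (hab : a ≤ b) :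
    ∫ t in a..b, 1 / Real.sqrt t = 2 * (Real.sqrt b - Real.sqrt a) := by
  have hderiv : ∀ t ∈ Set.uIcc a b, HasDerivAt (fun u => 2 * Real.sqrt u) (1 / Real.sqrt t) t := by
    intro t ht; rw [Set.uIcc_of_le hab] at ht
    have ht0 : t ≠ 0 := by linarith [ht.1]
    have hs : 0 < Real.sqrt t := Real.sqrt_pos.2 (by linarith [ht.1])
    refine ((Real.hasDerivAt_sqrt ht0).const_mul 2).congr_deriv ?_
    field_simp
  have hcont : ContinuousOn (fun t => 1 / Real.sqrt t) (Set.uIcc a b) := by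
    rw [Set.uIcc_of_le hab]
    apply ContinuousOn.div continuousOn_const Real.continuous_sqrt.continuousOn
    intro t ht; exact (Real.sqrt_pos.2 (by linarith [ht.1])).ne'
  rw [intervalIntegral.integral_eq_sub_of_hasDerivAt hderiv hcont.intervalIntegrable]; ring

/-! ## 4. Pointwise bounds for `θ` PROVED in the tree -/

/-- The tree's certified table, two-sided: for `599 ≤ t ≤ 8886113`,
`t − √t·log² t/(8π) ≤ θ(t) ≤ t + √t·log² t/(8π)`. [cite: Schoenfeld1976, Thm. 10 (6.3) (range certified in the tree)] -/
theorem theta_table {t : ℝ} (h1 : 599 ≤ t) (h2 : t ≤ 8886113) :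
    t - Real.sqrt t * Real.log t ^ 2 / (8 * Real.pi) ≤ θ t ∧
      θ t ≤ t + Real.sqrt t * Real.log t ^ 2 / (8 * Real.pi) := by
  have h := Literature.NumberTheory.LFunctions.abs_theta_sub_le_smallRange h1 h2
  rw [abs_le] at h
  constructor <;> linarith [h.1, h.2]

/-- Beyond the table: for `t ≥ 8886113`, `θ(t) ≤ ψ(t) ≤ 1.0722·t + 7·√t ≤ 1.075·t` (`√t ≥ 2500`), from the tree's
Chebyshev–Sylvester bound. [cite: Sylvester1892, pp. 87–120 (scheme [1,6,70;2,3,5,7,210]; weak corollary θ ≤ 1.075 t for t ≥ 8886113)] -/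
theorem theta_le_large {t : ℝ} (ht : 8886113 ≤ t) : θ t ≤ 1.075 * t := by
  have h1 := Chebyshev.theta_le_psi t
  have h2 := Literature.NumberTheory.LFunctions.psi_le_sylvester (x := t) (by linarith)
  have hs : (2500 : ℝ) ≤ Real.sqrt t := Real.le_sqrt_of_sq_le (by nlinarith)
  have hs2 : Real.sqrt t * Real.sqrt t = t := Real.mul_self_sqrt (by linarith)
  nlinarith [mul_le_mul_of_nonneg_right hs (Real.sqrt_nonneg t)]

/-! ## 5. The integral `∫ θ(t)/(t·log² t) dt` -/

/-- Interval-integrability of `θ(t)/(t log² t)` on `[a, b] ⊆ [2, b]` (Mathlib). [folklore] -/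
private theorem intInt {a b : ℝ} (ha : 2 ≤ a) (hab : a ≤ b) :
    IntervalIntegrable (fun t ↦ θ t / (t * Real.log t ^ 2)) volume a b := by
  have h := Chebyshev.integrableOn_theta_div_id_mul_log_sq b
  refine (h.mono_set ?_).intervalIntegrable
  rw [Set.uIcc_of_le hab]
  exact Set.Icc_subset_Icc ha le_rfl

/-- **The table segment**: for `1024 ≤ x ≤ 8886113`,
`∫_{1024}^x θ(t)/(t log² t) dt ≤ (x/log² x − 1024/log² 1024)/0.7114 + (√x − 32)/(4π)`
(integrand `≤ 1/log² t + 1/(8π√t)` by the certified table; `1 − 2/log t ≥ 0.7114` for `t ≥ 1024`).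
[cite: Schoenfeld1976, Thm. 10 (6.3) (consequence of the table on [1024, 8886113], certified in the tree)] -/
theorem integral_table_le {x : ℝ} (hx : 1024 ≤ x) (hx' : x ≤ 8886113) :
    ∫ t in (1024:ℝ)..x, θ t / (t * Real.log t ^ 2) ≤
      (x / Real.log x ^ 2 - 1024 / Real.log 1024 ^ 2) / 0.7114 + (Real.sqrt x - 32) / (4 * Real.pi) := by
  have hpt : ∀ t ∈ Set.Icc (1024:ℝ) x,
      θ t / (t * Real.log t ^ 2) ≤ 1 / Real.log t ^ 2 + (1 / (8 * Real.pi)) * (1 / Real.sqrt t) := by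
    intro t ht
    have ht0 : 0 < t := by linarith [ht.1]
    have hlt : 0 < Real.log t := Real.log_pos (by linarith [ht.1])
    have hst : 0 < Real.sqrt t := Real.sqrt_pos.2 ht0
    have hlne : Real.log t ≠ 0 := hlt.ne'
    have hsne : Real.sqrt t ≠ 0 := hst.ne'
    have htab := (theta_table (by linarith [ht.1]) (le_trans ht.2 hx')).2
    rw [div_le_iff₀ (by positivity)]
    have e : (1 / Real.log t ^ 2 + 1 / (8 * Real.pi) * (1 / Real.sqrt t)) * (t * Real.log t ^ 2)
        = t + (t / Real.sqrt t) * Real.log t ^ 2 / (8 * Real.pi) := by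
      field_simp
    rw [e, Real.div_sqrt]
    exact htab
  have hcl : ∀ t ∈ Set.Icc (1024:ℝ) x, (0.7114 : ℝ) ≤ 1 - 2 / Real.log t := by
    intro t ht
    have hlt : Real.log 1024 ≤ Real.log t := Real.log_le_log (by norm_num) ht.1
    have hl0 := log_1024_bounds.1
    have hlogt : 0 < Real.log t := by linarith
    have h2 : 2 / Real.log t ≤ 0.2886 := by
      rw [div_le_iff₀ hlogt]; nlinarith
    linarith
  have hI1 := integral_inv_log_sq_le (a := 1024) (b := x) (c := 0.7114) (by norm_num) hx (by norm_num) hcl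
  have hI2 := integral_inv_sqrt (a := 1024) (b := x) (by norm_num) hx
  have hg1 : IntervalIntegrable (fun t : ℝ => 1 / Real.log t ^ 2) volume 1024 x :=
    (continuousOn_inv_log_pow 2 (by norm_num) hx).intervalIntegrable
  have hg2 : IntervalIntegrable (fun t : ℝ => 1 / Real.sqrt t) volume 1024 x := by
    apply ContinuousOn.intervalIntegrable
    rw [Set.uIcc_of_le hx]
    apply ContinuousOn.div continuousOn_const Real.continuous_sqrt.continuousOn
    intro t ht; exact (Real.sqrt_pos.2 (by linarith [ht.1])).ne'
  have hmono := intervalIntegral.integral_mono_on hx (intInt (by norm_num) hx)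
    (hg1.add (hg2.const_mul (1 / (8 * Real.pi)))) hpt
  rw [intervalIntegral.integral_add hg1 (hg2.const_mul _), intervalIntegral.integral_const_mul, hI2,
    sqrt_1024] at hmono
  have e2 : 1 / (8 * Real.pi) * (2 * (Real.sqrt x - 32)) = (Real.sqrt x - 32) / (4 * Real.pi) := by
    field_simp; ring
  rw [e2] at hmono
  linarith [hI1]

/-- **Beyond the table**: for `8886113 ≤ a ≤ x`, `∫ₐˣ θ(t)/(t log² t) dt ≤ 1.075·(8/7)·(x/log² x − a/log² a)`
(`θ ≤ 1.075 t` there and `1 − 2/log t ≥ 7/8` as `log t ≥ 16`).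
[cite: Sylvester1892, pp. 87–120 (consequence of the Chebyshev–Sylvester bound, via the tree's psi_le_sylvester)] -/
theorem integral_large_le {a x : ℝ} (ha : 8886113 ≤ a) (hax : a ≤ x) :
    ∫ t in a..x, θ t / (t * Real.log t ^ 2) ≤ 1.075 * ((x / Real.log x ^ 2 - a / Real.log a ^ 2) / (7 / 8)) := by
  have h16 : ∀ t : ℝ, 8886113 ≤ t → 16 ≤ Real.log t := fun t ht => by
    have := Literature.NumberTheory.LFunctions.exp_sixteen_lt
    have h' : Real.exp 16 < t := lt_of_lt_of_le this ht
    exact ((Real.lt_log_iff_exp_lt (by linarith)).2 h').le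
  have hpt : ∀ t ∈ Set.Icc a x, θ t / (t * Real.log t ^ 2) ≤ 1.075 * (1 / Real.log t ^ 2) := by
    intro t ht
    have ht0 : 0 < t := by linarith [ht.1]
    have hlt : 0 < Real.log t := by linarith [h16 t (by linarith [ht.1])]
    have hθ := theta_le_large (t := t) (by linarith [ht.1])
    rw [div_le_iff₀ (by positivity)]
    have e : 1.075 * (1 / Real.log t ^ 2) * (t * Real.log t ^ 2) = 1.075 * t := by field_simp
    rw [e]; exact hθ
  have hcl : ∀ t ∈ Set.Icc a x, (7 / 8 : ℝ) ≤ 1 - 2 / Real.log t := by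
    intro t ht
    have hl := h16 t (by linarith [ht.1])
    have hlogt : 0 < Real.log t := by linarith
    have h2 : 2 / Real.log t ≤ 1 / 8 := by rw [div_le_iff₀ hlogt]; linarith
    linarith
  have ha1 : (1:ℝ) < a := by linarith
  have hI1 := integral_inv_log_sq_le (a := a) (b := x) (c := 7 / 8) ha1 hax (by norm_num) hcl
  have hg1 : IntervalIntegrable (fun t : ℝ => 1 / Real.log t ^ 2) volume a x :=
    (continuousOn_inv_log_pow 2 ha1 hax).intervalIntegrable
  have hmono := intervalIntegral.integral_mono_on hax (intInt (by linarith) hax) (hg1.const_mul 1.075) hpt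
  rw [intervalIntegral.integral_const_mul] at hmono
  exact hmono.trans (mul_le_mul_of_nonneg_left hI1 (by norm_num))

/-- `π(1024) = 172` (Legendre's identity with `s = 32`, kernel count). [folklore] -/
private theorem primeCounting_1024 : π 1024 = 172 := by
  rw [Literature.Barriers.Parity.primeCounting_eq_add_card_coprime_factorial (s := 32) (by norm_num) (by norm_num)]
  decide +kernel

/-- Abel summation at `x = 1024`: `∫₂^{1024} θ(t)/(t log² t) dt = 172 − θ(1024)/log 1024` (`π(1024) = 172`).
[cite: RosserSchoenfeld1962, §4–§5 (π from θ by partial summation; the instance x = 1024)] -/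
theorem integral_two_1024 :
    ∫ t in (2:ℝ)..1024, θ t / (t * Real.log t ^ 2) = 172 - θ 1024 / Real.log 1024 := by
  have h := Chebyshev.primeCounting_eq_theta_div_log_add_integral (x := (1024:ℝ)) (by norm_num)
  have hfl : ⌊(1024:ℝ)⌋₊ = 1024 := by
    rw [show (1024 : ℝ) = ((1024 : ℕ) : ℝ) by norm_num, Nat.floor_natCast]
  rw [hfl, primeCounting_1024] at h
  push_cast at h
  linarith


end EtaPrmSixty

end Literature.IUT.LogVolume

end
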